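import Summits.BirchSwinnertonDyer.Rank1Residual.X2.RankOneRegulatorBSD
import Summits.BirchSwinnertonDyer.Rank1Residual.X2.RankOneParitySqueeze
import Literature.NumberTheory.EllipticCurves.PAdicHeightsRegulatorProofs
import HarnessLib

/-!
# Class X2, sub-cell X2c (rank one), NON-SPLIT `p`: the §4.2 height lies in `pℤ_p`, so the
# regulator valuation needs no height computation when the generator's admissible multiple is
# prime to `p` — height-free `BSD(E,p)` at λ-minimal pairs and height-free route P
# (cell `b2b-bsdres`, unit `b2b-bsdres-eisenstein-p2`, gen 5)

HONEST FRAMING (run/shared/lean/b2b/bsd-rank1-residual/, verbatim in every file): the goal of the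
cell is to DELETE the COMBINATION-SHAPED residual classes of the Birch–Swinnerton-Dyer formula for
ALL analytic-rank `≤ 1` elliptic curves over `ℚ` — "full BSD formula for every rank `≤ 1` curve in
class `C`" assembled STRICTLY from published theorems — so that the rank-`≤ 1` remainder becomes
exactly the CONSTRUCTION-SHAPED classes, which are TYPED (missing-input `Prop`s), NOT attempted.
This is not "finishing BSD". Research route; NO CLAIM BEYOND STATED CLASSES; nothing here changes
a label; X2c stays CONSTRUCTION-SHAPED. Theorems only (no definition, no named fact).

WHAT. For odd `p` the Iwasawa logarithm maps `ℚ_p` into `pℤ_p` (`‖log_p x‖ ≤ p⁻¹`: `log_p p = 0`,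
`log_p` of a unit `u` is `(p−1)⁻¹·L(u^{p−1})` with `u^{p−1} ≡ 1 (mod p)` and `‖L(y)‖ = ‖1 − y‖`). The
Stein–Wuthrich §4.2 height at a NON-split multiplicative prime is formula (4.1),
`ĥ_p(P) = log_p(den x(P)) − log_p(C²σ_q(u(P))²)` (tree `heightFourOne`), a difference of two such
logarithms: **`‖ĥ_p(P)‖ ≤ p⁻¹` for every point** (`norm_heightFourOne_le`). Hence for THE §4.2 height
datum `Dh` (`IsMultCanonical Dh q`) and a Mordell–Weil generator `P` of `E(ℚ)/tors` (rank one) with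
an ADMISSIBLE multiple `n·P`, `p ∤ n` (a per-pair exact-arithmetic certificate: `n` clears the
component groups and `#Ẽ_ns(𝔽_p) = p + 1`, so such `n` exists iff the generator meets no component
of order divisible by `p`): `Reg_p(E,Dh) = ĥ_p(nP)/n²`, so **`Reg_p ≠ 0 ⇒ ord_p Reg_p(E,Dh) ≥ 1`**
(`one_le_valuation_padicRegulator_of_admissible`) — with NO `p`-adic height computed.

Consequences at an X2c pair with non-split `p` (`ε_p = 2`), combined with gen 5's
`X2/RankOneRegulator(BSD).lean` and `X2/RankOneParitySqueeze.lean`: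
* `shaValuation_eq_zero_of_lamMin_nonsplit_heightFree`: `(μ_an, λ_an) = (0, 1)`, `p ∤ #E(ℚ)_tors`
  and such a certificate `(P, n)` ⇒ `p ∤ #Ш(E/ℚ)[p^∞]` (i.e. `Ш[p^∞] = 0`), `p ∤ ∏c_ℓ`, and
  `ord_p Reg_p(E,Dh) = 1` EXACTLY (the identity `ord_p #Ш[p^∞] + ord_p Reg_p + ord_p ∏c = 1` with
  `ord_p Reg_p ≥ 1`); `bsdp_of_lamMin_nonsplit_heightFree`: with `ord_p #Ш_an = 0`, **`BSD(E,p)`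
  with no height and no `p`-adic `L`-series coefficient computed** — inputs: the two-engine bits
  `(μ, λ)`, `p ∤ #tors`, the exact-arithmetic admissibility of `nP`, `#Ш_an`.
  (Census, N < 2·10⁴: 21 non-split λ-minimal X2c pairs have `p ∤ #tors·∏c_ℓ`, e.g. `2550u1@3`,
  `2850s1@3`, `5100g1@3`, `5700d1@3`; the 69 with `p ∣ ∏c_ℓ` necessarily have `p ∣ n`.)
* `mazurMainConjectureAt_of_routeP_rankOne_nonsplit_heightFree`: route P at `λ_an = 3` with the
  regulator bound DISCHARGED (`v = 1`): `(μ_an, λ_an) = (0, 3)`, `p ∤ #tors`, `p ∣ ∏c_ℓ` and a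
  certificate `(P, n)` ⇒ Mazur's main conjecture at the pair, height-free (census: 13 non-split
  λ-excess-2 X2c pairs have `p ∣ ∏c_ℓ`, e.g. `4080u1@3`, `4998j1@3`).
The split case is NOT treated (the modified height subtracts `log_p(u)²/log_p(q_E)`, whose
valuation `≥ 2 − ord_p log_p q_E` can be negative: gen 4 found `ord_p log_p q_E` up to `7`).

References: [SteinWuthrich2013] §4.1 (4.1), §4.2 (p. 15), Thm. 6.1 (p. 20); [Iwasawa1972PadicL]
§4.4; [MazurSteinTate2006] §1; [MazurTateTeitelbaum1986] §II.4; HOME/b2b-bsdres-eisenstein-p2/X2-GAP.md §10.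
-/

set_option autoImplicit false

noncomputable section

open scoped Classical MatrixGroups ModularForm

open PowerSeries CongruenceSubgroup WeierstrassCurve Literature.NumberTheory.EllipticCurves
  Literature.NumberTheory.EllipticCurves.ModularForms
  Literature.NumberTheory.EllipticCurves.Rank1Residual
  Literature.NumberTheory.EllipticCurves.Rank1Residual.Typed
  Literature.NumberTheory.EllipticCurves.Wuthrich2014
  Literature.NumberTheory.EllipticCurves.SteinWuthrich2013
  Literature.NumberTheory.EllipticCurves.Greenberg1999

namespace Summit.BirchSwinnertonDyer.Rank1Residual.X2

/-! ## §1. `log_p(ℚ_p) ⊆ pℤ_p` for odd `p` -/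

section Log

variable {p : ℕ} [Fact p.Prime]

/-- `‖(p : ℚ_p) − 1‖ = 1` (ultrametric: `‖p‖ < ‖1‖`). [folklore] -/
theorem norm_natCast_prime_sub_one : ‖(p : ℚ_[p]) - 1‖ = 1 := by
  have hp : p.Prime := Fact.out
  have h1 : ‖(-1 : ℚ_[p])‖ = 1 := by rw [norm_neg, norm_one]
  have hne : ‖(p : ℚ_[p])‖ ≠ ‖(-1 : ℚ_[p])‖ := by
    rw [h1]; exact (Padic.norm_p_lt_one).ne
  rw [sub_eq_add_neg, Padic.add_eq_max_of_ne hne, h1, max_eq_right (Padic.norm_p_lt_one).le]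

/-- **`‖log_p x‖ ≤ p⁻¹` for every `x ∈ ℚ_p`, `p` odd** (the Iwasawa logarithm takes values in
`pℤ_p`: `log_p 0 = log_p p = 0`; for a unit `u`, `log_p u = (p−1)⁻¹ L(u^{p−1})` with
`‖1 − u^{p−1}‖ ≤ p⁻¹ < ‖2‖` and `‖L(y)‖ = ‖1 − y‖` there). [cite: Iwasawa1972PadicL, §4.4] -/
theorem norm_padicLog_le (hp2 : p ≠ 2) (x : ℚ_[p]) : ‖padicLog p x‖ ≤ (p : ℝ)⁻¹ := by
  have hp : p.Prime := Fact.out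
  by_cases hx : x = 0
  · rw [hx, padicLog_zero, norm_zero]; positivity
  rw [padicLog_of_ne_zero hx]
  set y : ℚ_[p] := (x * (p : ℚ_[p]) ^ (-x.valuation)) ^ (p - 1) with hy
  have hy1 : ‖1 - y‖ < 1 := norm_one_sub_pow_sub_one_lt (norm_mul_zpow_neg_valuation hx)
  have hyp : ‖1 - y‖ ≤ (p : ℝ)⁻¹ := norm_le_inv_of_norm_lt_one hy1
  have h2 : ‖(2 : ℚ_[p])‖ = 1 := by
    rw [Padic.norm_eq_zpow_neg_valuation two_ne_zero, valuation_two_eq_zero hp2, neg_zero, zpow_zero]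
  have hlt2 : ‖1 - y‖ < ‖(2 : ℚ_[p])‖ := by rw [h2]; exact hy1
  rw [norm_mul, norm_inv, norm_natCast_prime_sub_one, inv_one, one_mul, norm_padicLogSeries_eq hlt2]
  exact hyp

/-- From a norm bound to a valuation bound: `x ≠ 0`, `‖x‖ ≤ p⁻¹ ⇒ 1 ≤ ord_p x`. [folklore] -/
theorem one_le_valuation_of_norm_le_inv {x : ℚ_[p]} (hx : x ≠ 0) (h : ‖x‖ ≤ (p : ℝ)⁻¹) :
    1 ≤ x.valuation := by
  have hp : p.Prime := Fact.out
  have hp1 : (1 : ℝ) < p := by exact_mod_cast hp.one_lt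
  rw [Padic.norm_eq_zpow_neg_valuation hx, ← zpow_neg_one] at h
  have := (zpow_le_zpow_iff_right₀ hp1).mp h
  omega

end Log

/-! ## §2. The §4.2 height at a non-split prime lies in `pℤ_p`; the regulator valuation -/

section Height

variable {W : WeierstrassCurve ℚ} [W.IsElliptic] [W.IsGloballyMinimal] {p : ℕ} [Fact p.Prime]

/-- **`‖ĥ_p(P)‖ ≤ p⁻¹` for SW's formula (4.1) at every point** (`p` odd): `heightFourOne` is
`log_p(den x) − log_p(C²σ²)`, each of norm `≤ p⁻¹`. [cite: SteinWuthrich2013, §4.1 eq. (4.1) and §4.2 (p. 15)]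
[cite: Iwasawa1972PadicL, §4.4] -/
theorem norm_heightFourOne_le (W : WeierstrassCurve ℚ) (p : ℕ) [Fact p.Prime] (hp2 : p ≠ 2)
    (q : ℚ_[p]) (P : W.toAffine.Point) : ‖heightFourOne W p q P‖ ≤ (p : ℝ)⁻¹ := by
  rcases P with _ | ⟨x, y, h⟩
  · show ‖(0 : ℚ_[p])‖ ≤ _
    rw [norm_zero]; positivity
  · show ‖heightFourOneCoord W p q x y‖ ≤ _
    rw [heightFourOneCoord, sub_eq_add_neg]
    refine (Padic.nonarchimedean _ _).trans (max_le (norm_padicLog_le hp2 _) ?_)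
    rw [norm_neg]; exact norm_padicLog_le hp2 _

omit [W.IsElliptic] [W.IsGloballyMinimal] in
/-- **Height-free regulator bound at a non-split prime.** For THE §4.2 height datum `Dh`
(`IsMultCanonical Dh q`), a Mordell–Weil generator `P` of `E(ℚ)/tors` (rank one:
`IsMordellWeilBasis ![P]`) and an ADMISSIBLE multiple `n·P` with `p ∤ n`:
`Reg_p(E,Dh) = ⟨P,P⟩ = ĥ_p(nP)/n²`, so `Reg_p ≠ 0 ⇒ 1 ≤ ord_p Reg_p(E,Dh)`. No height is computed.
[cite: SteinWuthrich2013, §4.2 (p. 15)] [cite: MazurTateTeitelbaum1986Invent, §II.4] [cite: MazurSteinTate2006, §1] -/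
theorem one_le_valuation_padicRegulator_of_admissible (hp2 : p ≠ 2) {q : ℚ_[p]}
    {Dh : PAdicHeightData W p} (hDh : IsMultCanonical Dh q)
    {P : W.toAffine.Point} (hP : IsMordellWeilBasis ![P]) {n : ℕ} (hn : ¬ p ∣ n)
    (hadm : W.IsAdmissible p (n • P)) (hReg : padicRegulator Dh ≠ 0) :
    1 ≤ (padicRegulator Dh).valuation := by
  have hp : p.Prime := Fact.out
  -- `Reg_p = ⟨P, P⟩`
  have hReg1 : padicRegulator Dh = Dh.pairing P P := by
    rw [← hP.padicRegulatorOf_eq_padicRegulator Dh, padicRegulatorOf]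
    have e : Dh.pairingMatrix ![P] 0 0 = Dh.pairing P P := by simp [PAdicHeightData.pairingMatrix]
    rw [← e]
    convert Matrix.det_fin_one (Dh.pairingMatrix ![P])
  -- `⟨nP, nP⟩ = n² ⟨P, P⟩ = ĥ_p(nP)`
  have hnn : Dh.pairing (n • P) (n • P) = ((n : ℚ_[p]) * (n : ℚ_[p])) * padicRegulator Dh := by
    rw [hReg1, map_nsmul, Dh.symm (n • P) P, map_nsmul, smul_smul, nsmul_eq_mul, Nat.cast_mul]
  have hh : ‖((n : ℚ_[p]) * (n : ℚ_[p])) * padicRegulator Dh‖ ≤ (p : ℝ)⁻¹ := by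
    rw [← hnn, hDh (n • P) hadm]
    exact norm_heightFourOne_le W p hp2 q (n • P)
  -- `‖n‖ = 1`
  have hn1 : ‖(n : ℚ_[p])‖ = 1 := by
    have hle : ‖((n : ℤ) : ℚ_[p])‖ ≤ 1 := Padic.norm_int_le_one (n : ℤ)
    have hnlt : ¬ ‖((n : ℤ) : ℚ_[p])‖ < 1 := by
      rw [Padic.norm_intCast_lt_one_iff]; exact_mod_cast hn
    push_cast at hle hnlt
    exact le_antisymm hle (not_lt.mp hnlt)
  rw [norm_mul, norm_mul, hn1, one_mul, one_mul] at hh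
  exact one_le_valuation_of_norm_le_inv hReg hh

end Height

/-! ## §3. Height-free `BSD(E,p)` at a λ-minimal X2c pair, non-split `p` -/

section HeightFree

variable {W : WeierstrassCurve ℚ} [W.IsElliptic] [W.IsGloballyMinimal] {p : ℕ} [Fact p.Prime]

/-- **λ-minimal X2c pair, non-split `p`, no rational `p`-torsion, `p`-primitive admissible multiple:
`p ∤ #Ш(E/ℚ)[p^∞]`, `p ∤ ∏c_ℓ` and `ord_p Reg_p(E,Dh) = 1` — no height computed.** Data/facts as in
`schneider_and_shaIdentity_of_lamMin_nonsplit` (`hWu hJn hGZK hpar`; `(μ_an, λ_an) = (0, 1)`), plus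
`p ∤ #E(ℚ)_tors` and the certificate `(P, n)`: `IsMordellWeilBasis ![P]`, `p ∤ n`, `n·P` admissible.
Proof: the identity `ord_p #Ш[p^∞] + ord_p Reg_p + ord_p ∏c = 1 + 2·0` with `ord_p Reg_p ≥ 1`.
[cite: SteinWuthrich2013, Thm. 6.1 (p. 20) and §4.2 (p. 15)] [cite: Wuthrich2014, Thm. 16]
[cite: Iwasawa1972PadicL, §4.4] -/
theorem shaValuation_eq_zero_of_lamMin_nonsplit_heightFree
    (hWu : thm16_charIdeal_dvd_multiplicative_of_reducible) (hJn : thm61_nonsplitMultiplicative)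
    (hGZK : rank_eq_analyticRank_of_analyticRank_le_one) (hpar : nonempty_modularParametrizationData)
    (W : WeierstrassCurve ℚ) [W.IsElliptic] [W.IsGloballyMinimal] (p : ℕ) [Fact p.Prime]
    (hp2 : p ≠ 2) (hmult : W.HasMultiplicativeReductionAtPrime p)
    (hns : ¬ W.HasSplitMultiplicativeReductionAtPrime p)
    (hred : ¬ W.HasIrreducibleModPGaloisRep p) (hr : W.analyticRank = 1)
    {q : ℚ_[p]} (hq0 : q ≠ 0) (hq1 : ‖q‖ < 1) (hqj : tateJ q = (W.j : ℚ_[p]))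
    {Dh : PAdicHeightData W p} (hDh : IsMultCanonical Dh q)
    (hμ0 : AnalyticMuLE W p 0) (hlam : AnalyticLambdaEq W p 1)
    (htors : ¬ p ∣ W.torsionOrder)
    {P : W.toAffine.Point} (hP : IsMordellWeilBasis ![P]) {n : ℕ} (hn : ¬ p ∣ n)
    (hadm : W.IsAdmissible p (n • P)) :
    padicValNat p (Nat.card (AddCommGroup.primaryComponent W.sha p)) = 0 ∧
      padicValNat p W.tamagawaProduct = 0 ∧ (padicRegulator Dh).valuation = 1 := by
  obtain ⟨hSch, hid⟩ := schneider_and_shaIdentity_of_lamMin_nonsplit hWu hJn hGZK hpar W p hp2 hmult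
    hns hred hr hq0 hq1 hqj hDh hμ0 hlam
  have hReg := one_le_valuation_padicRegulator_of_admissible hp2 hDh hP hn hadm hSch
  have ht0 : padicValNat p W.torsionOrder = 0 := padicValNat.eq_zero_of_not_dvd htors
  rw [ht0, Nat.cast_zero, mul_zero, add_zero] at hid
  refine ⟨?_, ?_, ?_⟩ <;> omega

/-- **Height-free `BSD(E,p)` at a λ-minimal X2c pair, non-split `p`**: `(μ_an, λ_an) = (0, 1)`,
`p ∤ #E(ℚ)_tors`, a `p`-primitive admissible multiple `n·P` of a Mordell–Weil generator, and
`ord_p #Ш_an = 0` ⇒ `BSD(E,p)` — no `p`-adic height and no `p`-adic `L`-series coefficient is computed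
beyond the two certified bits. Per pair; X2c stays CONSTRUCTION-SHAPED.
[cite: SteinWuthrich2013, Thm. 6.1 (p. 20) and §4.2 (p. 15)] [cite: Wuthrich2014, Thm. 16]
[cite: Miller2011LMS, Def. 1.1] -/
theorem bsdp_of_lamMin_nonsplit_heightFree
    (hWu : thm16_charIdeal_dvd_multiplicative_of_reducible) (hJn : thm61_nonsplitMultiplicative)
    (hGZK : rank_eq_analyticRank_of_analyticRank_le_one) (hpar : nonempty_modularParametrizationData)
    (W : WeierstrassCurve ℚ) [W.IsElliptic] [W.IsGloballyMinimal] (p : ℕ) [Fact p.Prime]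
    (hp2 : p ≠ 2) (hmult : W.HasMultiplicativeReductionAtPrime p)
    (hns : ¬ W.HasSplitMultiplicativeReductionAtPrime p)
    (hred : ¬ W.HasIrreducibleModPGaloisRep p) (hr : W.analyticRank = 1)
    {q : ℚ_[p]} (hq0 : q ≠ 0) (hq1 : ‖q‖ < 1) (hqj : tateJ q = (W.j : ℚ_[p]))
    {Dh : PAdicHeightData W p} (hDh : IsMultCanonical Dh q)
    (hμ0 : AnalyticMuLE W p 0) (hlam : AnalyticLambdaEq W p 1)
    (htors : ¬ p ∣ W.torsionOrder)
    {P : W.toAffine.Point} (hP : IsMordellWeilBasis ![P]) {n : ℕ} (hn : ¬ p ∣ n)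
    (hadm : W.IsAdmissible p (n • P)) {s : ℚ} (hs : shaAn W = (s : ℂ)) (hv : padicValRat p s = 0) :
    BSDp W p := by
  obtain ⟨hsha, -, -⟩ := shaValuation_eq_zero_of_lamMin_nonsplit_heightFree hWu hJn hGZK hpar W p
    hp2 hmult hns hred hr hq0 hq1 hqj hDh hμ0 hlam htors hP hn hadm
  obtain ⟨hrank, hfinsha⟩ := hGZK W hr.le
  haveI : Finite W.sha := hfinsha
  have hfin : Finite (AddCommGroup.primaryComponent W.sha p) := inferInstance
  rw [bsdp_iff_padicValRat_eq_of_shaAn_eq W p hrank hfin hs, hv, hsha, Nat.cast_zero]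

/-- **Sub-cell form (non-split clause only), height datum quantified under its pinning predicate**:
on `CellC W p` at a NON-split prime, `(μ_an, λ_an) = (0, 1)`, `p ∤ #tors`, a `p`-primitive admissible
multiple of a generator and `ord_p #Ш_an = 0` ⇒ `BSD(E,p)`. [cite: SteinWuthrich2013, Thm. 6.1 (p. 20) and §4.2]
[cite: Wuthrich2014, Thm. 16] [cite: Miller2011LMS, Def. 1.1] -/
theorem cellC_bsdp_of_lamMin_nonsplit_heightFree
    (hWu : thm16_charIdeal_dvd_multiplicative_of_reducible) (hJn : thm61_nonsplitMultiplicative)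
    (hHn : exists_isMultCanonical)
    (hGZK : rank_eq_analyticRank_of_analyticRank_le_one) (hpar : nonempty_modularParametrizationData)
    (W : WeierstrassCurve ℚ) [W.IsElliptic] [W.IsGloballyMinimal] (p : ℕ) [Fact p.Prime]
    (hc : CellC W p) (hns : ¬ W.HasSplitMultiplicativeReductionAtPrime p)
    (hμ0 : AnalyticMuLE W p 0) (hlam : AnalyticLambdaEq W p 1) (htors : ¬ p ∣ W.torsionOrder)
    {P : W.toAffine.Point} (hP : IsMordellWeilBasis ![P]) {n : ℕ} (hn : ¬ p ∣ n)
    (hadm : W.IsAdmissible p (n • P)) {s : ℚ} (hs : shaAn W = (s : ℂ)) (hv : padicValRat p s = 0) :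
    BSDp W p := by
  obtain ⟨hr, hp2, hred, hmult⟩ := hc
  obtain ⟨q, ⟨hq0, hq1, hqj⟩, -⟩ := existsUnique_tateJ_eq_of_one_lt_norm
    (one_lt_norm_j_of_hasMultiplicativeReductionAtPrime (W := W) (p := p) hmult)
  obtain ⟨Dh, hDh⟩ := hHn W p hp2 hmult hns q hq0 hq1 hqj
  exact bsdp_of_lamMin_nonsplit_heightFree hWu hJn hGZK hpar W p hp2 hmult hns hred hr hq0 hq1 hqj hDh
    hμ0 hlam htors hP hn hadm hs hv

/-! ## §4. Height-free route P at rank one, non-split `p` -/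

/-- **Route P at `λ_an = 3`, non-split `p`, with the regulator bound DISCHARGED**: `(μ_an, λ_an) =
(0, 3)`, `p ∤ #E(ℚ)_tors`, `p ∣ ∏c_ℓ`, and a `p`-primitive admissible multiple of a Mordell–Weil
generator ⇒ Mazur's main conjecture at the pair (`v = 1` in
`mazurMainConjectureAt_of_routeP_rankOne_nonsplit_of_not_dvd_torsionOrder`; no height computed).
[cite: GreenbergLNM1716, Prop. 3.10 and §5 p. 183] [cite: Wuthrich2014, Thm. 16]
[cite: SteinWuthrich2013, Thm. 6.1 (p. 20) and §4.2 (p. 15)] [cite: Iwasawa1972PadicL, §4.4] -/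
theorem mazurMainConjectureAt_of_routeP_rankOne_nonsplit_heightFree
    (hWu : thm16_charIdeal_dvd_multiplicative_of_reducible)
    (hJs : thm61_splitMultiplicative) (hJn : thm61_nonsplitMultiplicative)
    (hHs : exists_isSplitMultCanonical) (hHn : exists_isMultCanonical)
    (h310 : prop310_selmerCorank_mod_two_eq_lambdaInvariant)
    (hGZK : rank_eq_analyticRank_of_analyticRank_le_one)
    (W : WeierstrassCurve ℚ) [W.IsElliptic] [W.IsGloballyMinimal] (p : ℕ) [Fact p.Prime]
    (hp2 : p ≠ 2) (hmult : W.HasMultiplicativeReductionAtPrime p)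
    (hns : ¬ W.HasSplitMultiplicativeReductionAtPrime p)
    (hred : ¬ W.HasIrreducibleModPGaloisRep p) (hr : W.analyticRank = 1)
    (hμ0 : AnalyticMuLE W p 0) (hlam3 : AnalyticLambdaEq W p 3)
    (htors : ¬ p ∣ W.torsionOrder) (htam : p ∣ W.tamagawaProduct)
    {P : W.toAffine.Point} (hP : IsMordellWeilBasis ![P]) {n : ℕ} (hn : ¬ p ∣ n)
    (hadm : W.IsAdmissible p (n • P)) :
    X2.MazurMainConjectureAt W p := by
  have hp : p.Prime := Fact.out
  have hc1 : 1 ≤ padicValNat p W.tamagawaProduct :=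
    one_le_padicValNat_of_dvd (W.tamagawaProduct_pos').ne' htam
  refine mazurMainConjectureAt_of_routeP_rankOne_nonsplit_of_not_dvd_torsionOrder hWu hJs hJn hHs
    hHn h310 hGZK W p hp2 hmult hns hred hr hμ0 hlam3 htors (v := 1)
    (fun q Dh _ _ _ hDh hReg ↦ one_le_valuation_padicRegulator_of_admissible hp2 hDh hP hn hadm hReg)
    ?_
  have : (1 : ℤ) ≤ padicValNat p W.tamagawaProduct := by exact_mod_cast hc1
  linarith

end HeightFree

end Summit.BirchSwinnertonDyer.Rank1Residual.X2

end
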